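import Summits.QuantumFields.BalabanUV.Beta.GAN24.SourceSidePair

/-!
# `BalabanUV.Beta.GAN24.SourceSideMajorant` — binder row G-an2-4 / (CONV-C), road P1-fibre, sub-part **PART S** of gan24-p1's row
# **P1-L11** `FibreRate` (leaf-20-g7's division of L11, CLAIMS l.3039; this seat's TAKE l.3074) — PART 1b: the ALIAS-BOX MAJORANT `mP`
# of the paired box factor, its box sums, the direction-wise decay off the zero alias, and complex product telescoping

NOT IN PRINT; OUR PROOF ATTEMPT.  HONEST FRAMING (cell contract, verbatim): «discharging `BetaPertH` makes Bałaban's UV stability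
UNCONDITIONAL — a real constructive-QFT result; it is NOT the continuum limit and NOT the Clay problem.»  HONEST DEPENDENCY (verbatim):
«continuum YM on T⁴ ⇐ BetaPertH ∧ nine spine estimates (0/9 proved); BetaPertH ⇐ (D1) ∧ (D4) ∧ CAP+tail; G-an2-4 gates asym, D1 and
NE2/3/4.»  [folklore] explicit real analysis (finite alias sums); 0 cite, 0 wall binder, no `def … : Prop`; one harmless real-valued `def`
(`mP`).  It discharges NOTHING of (CONV-C)'s K-slot `GAN24.CombesThomas.ConvCK 3 Lc` by itself — Part-B bookkeeping for the SOURCE-SIDE feed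
sums `S_φ`, `S_c` of the closed-form fibre function (T00 `AliasObjects.srcPhi/srcC` at the force source `fhatF`).  NOT `BetaPertH`, NOT
continuum, NOT Clay.  Value = kernel bookkeeping toward the K-slot route P1 of binder row G-an2-4, NOT summit progress.

## What is proved
* §3 the majorant `mP Lc z` (`= 1` at `z = 0`, `= Lc/z²` else): `‖pairP N M (s + 2πz)‖ ≤ mP Lc z` on the zone (`norm_pairP_shift_le`, from
  part 1's decay `π²Lc/Q²` and leaf P1-Y11s `pi_mul_abs_le`), the one-coordinate sum `Σ_{r ∈ ℤ/N} mP Lc (zrep N s r) ≤ 1 + 4Lc`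
  (`sum_inv_intSq_le_four` BY NAME) and the box sum **`sum_boxZ_prod_mP_le`**: `Σ_{z ∈ boxZ N q} Π_i mP Lc z_i ≤ (1 + 4Lc)^D`; the
  DIRECTION-WISE DECAY off the zero alias `1/|q + 2πz|² ≤ mP Lc z_i/π²` for every `i` (`inv_momSq_qv_le`) — which is what makes the
  label-uniform two-level rate `(π²/6)Lc/N²` of ONE paired factor summable over the box (the decay in its own direction is borrowed from
  `1/symN`);
* §4 complex product telescoping with majorants `norm_prod_sub_prod_le` (the `ℂ`-valued twin of
  `ReadingWeightRatesSum.abs_prod_sub_prod_le_sum`) and its instances for the `D`-fold paired product (`norm_prod_pairP_le`,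
  `norm_prod_pairP_sub_le`).

Unit `b2b-balaban-gan24-formalise-leaf-07` (G-an2-4 formalisation swarm, leaf prover 07, gen 6), 2026-08-20.
-/

noncomputable section

open Complex Finset
open scoped BigOperators Real

namespace Summit.QuantumFields.BalabanUV.Beta.GAN24.SourceSideMajorant

open AliasWeights AliasWeightsClosedForm SymbolTaylor CapacitanceScalarRate CapacitanceScalarRateTerm
  CapacitanceScalarRateBox CapacitanceScalarRateSum ReadingWeightRates SourceSidePair
open AliasObjects (gs)
open Literature.MathematicalPhysics.QuantumFieldTheory.King1986 (momSq momSq_nonneg)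

variable {D : ℕ}

/-! ## §3 The alias-box majorant `mP` and its sums -/

/-- The ALIAS MAJORANT of the paired factor at the integer alias `z`: `1` at the zero alias, `Lc/z²` elsewhere. -/
def mP (Lc : ℕ) (z : ℤ) : ℝ := if z = 0 then 1 else (Lc : ℝ) / (z : ℝ) ^ 2

/-- [folklore] `0 ≤ mP Lc z`. -/
theorem mP_nonneg (Lc : ℕ) (z : ℤ) : 0 ≤ mP Lc z := by
  unfold mP; split_ifs <;> positivity

/-- [folklore] `mP Lc 0 = 1`. -/
@[simp] theorem mP_zero (Lc : ℕ) : mP Lc 0 = 1 := by simp [mP]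

/-- [folklore] Off the zero alias: `1/z² ≤ mP Lc z` (`Lc ≥ 1`). -/
theorem inv_sq_le_mP {Lc : ℕ} (hLc : 1 ≤ Lc) {z : ℤ} (hz : z ≠ 0) : ((z : ℝ) ^ 2)⁻¹ ≤ mP Lc z := by
  unfold mP
  rw [if_neg hz, div_eq_mul_inv]
  have h1 : (1 : ℝ) ≤ Lc := by exact_mod_cast hLc
  have hz2 : 0 ≤ ((z : ℝ) ^ 2)⁻¹ := by positivity
  calc ((z : ℝ) ^ 2)⁻¹ = 1 * ((z : ℝ) ^ 2)⁻¹ := (one_mul _).symm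
    _ ≤ (Lc : ℝ) * ((z : ℝ) ^ 2)⁻¹ := mul_le_mul_of_nonneg_right h1 hz2

/-- [folklore] `mP Lc z ≤ Lc` (`Lc ≥ 1`). -/
theorem mP_le_Lc {Lc : ℕ} (hLc : 1 ≤ Lc) (z : ℤ) : mP Lc z ≤ Lc := by
  have h1 : (1 : ℝ) ≤ Lc := by exact_mod_cast hLc
  unfold mP
  split_ifs with hz
  · exact h1
  · have hz1 : (1 : ℝ) ≤ (z : ℝ) ^ 2 := by
      have : (1 : ℝ) ≤ |(z : ℝ)| := by rw [← Int.cast_abs]; exact_mod_cast Int.one_le_abs hz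
      calc (1 : ℝ) = 1 ^ 2 := by norm_num
        _ ≤ |(z : ℝ)| ^ 2 := pow_le_pow_left₀ zero_le_one this 2
        _ = (z : ℝ) ^ 2 := sq_abs _
    exact div_le_self (by positivity) hz1

/-- [folklore] **THE PAIRED FACTOR UNDER ITS MAJORANT**: at the label `Q = s + 2πz` of the zone (`|s| ≤ π`, `|Q| ≤ πN`),
`‖pairP N M Q‖ ≤ mP Lc z` (`≤ 1` at `z = 0`; `≤ π²Lc/Q² ≤ Lc/z²` else, by `CapacitanceScalarRateBox.pi_mul_abs_le`). -/
theorem norm_pairP_shift_le {N M Lc : ℕ} (hN : 0 < N) (hM : 0 < M) (hLc : 0 < Lc) (hNM : (N : ℝ) = M * Lc) {s : ℝ}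
    (hs : |s| ≤ π) {z : ℤ} (hQ : |s + 2 * π * (z : ℝ)| ≤ π * N) : ‖pairP N M (s + 2 * π * (z : ℝ))‖ ≤ mP Lc z := by
  unfold mP
  split_ifs with hz
  · exact norm_pairP_le_one hN hM _
  · have hπ := Real.pi_pos
    have hfar := pi_mul_abs_le hs hz
    have hz1 : (0 : ℝ) < |(z : ℝ)| := by
      have : (z : ℝ) ≠ 0 := by exact_mod_cast hz
      exact abs_pos.2 this
    have hQ0 : s + 2 * π * (z : ℝ) ≠ 0 := by
      intro h; rw [h, abs_zero] at hfar; nlinarith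
    refine (norm_pairP_le_div_sq hN hM hLc hNM hQ hQ0).trans ?_
    have hzz : 0 < (z : ℝ) ^ 2 := by positivity
    calc π ^ 2 * Lc / (s + 2 * π * (z : ℝ)) ^ 2 ≤ π ^ 2 * Lc / (π * |(z : ℝ)|) ^ 2 := by
          apply div_le_div_of_nonneg_left (by positivity) (by positivity)
          rw [← sq_abs (s + _)]; exact pow_le_pow_left₀ (by positivity) hfar 2
      _ = (Lc : ℝ) / (z : ℝ) ^ 2 := by field_simp; rw [sq_abs]

/-- [folklore] **ONE-COORDINATE MAJORANT SUM**: `Σ_{r ∈ ℤ/N} mP Lc (zrep N s r) ≤ 1 + 4Lc` (the zero alias `≤ 1`, the rest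
`≤ Lc·Σ_{z≠0} 1/z² ≤ 4Lc` by leaf P1-Y11s `sum_inv_intSq_le_four` BY NAME). -/
theorem sum_mP_zrep_le {N : ℕ} [NeZero N] (Lc : ℕ) (s : ℝ) :
    ∑ r : ZMod N, mP Lc (zrep N s r) ≤ 1 + 4 * Lc := by
  classical
  have hinj : Set.InjOn (zrep N s) ↑(Finset.univ : Finset (ZMod N)) := fun a _ b _ h => by
    simpa [zrep_cast] using congrArg (fun z : ℤ => (z : ZMod N)) h
  rw [← Finset.sum_image (f := fun z : ℤ => mP Lc z) hinj]
  set W := (Finset.univ : Finset (ZMod N)).image (zrep N s)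
  rw [← Finset.sum_filter_add_sum_filter_not W (fun z => z = 0)]
  have h1 : ∑ z ∈ W.filter (fun z => z = 0), mP Lc z ≤ 1 := by
    rw [Finset.filter_eq' W 0]
    split_ifs
    · simp
    · simp
  have h2 : ∑ z ∈ W.filter (fun z => ¬z = 0), mP Lc z ≤ 4 * Lc := by
    calc ∑ z ∈ W.filter (fun z => ¬z = 0), mP Lc z
        = ∑ z ∈ W.filter (fun z => ¬z = 0), (Lc : ℝ) * ((z : ℝ) ^ 2)⁻¹ :=
          Finset.sum_congr rfl fun z hz => by
            unfold mP; rw [if_neg (Finset.mem_filter.1 hz).2, div_eq_mul_inv]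
      _ = (Lc : ℝ) * ∑ z ∈ W.filter (fun z => z ≠ 0), ((z : ℝ) ^ 2)⁻¹ := by rw [Finset.mul_sum]
      _ ≤ (Lc : ℝ) * 4 := mul_le_mul_of_nonneg_left (sum_inv_intSq_le_four W) (Nat.cast_nonneg Lc)
      _ = 4 * Lc := by ring
  linarith

/-- [folklore] **`D`-DIMENSIONAL MAJORANT SUM OVER THE ALIAS BOX**: `Σ_{z ∈ boxZ N p} Π_i mP Lc z_i ≤ (1 + 4Lc)^D`, all `N`, `p`. -/
theorem sum_boxZ_prod_mP_le {N : ℕ} [NeZero N] (Lc : ℕ) (p : Fin D → ℝ) :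
    ∑ z ∈ boxZ N p, ∏ i, mP Lc (z i) ≤ (1 + 4 * (Lc : ℝ)) ^ D := by
  rw [sum_boxZ]
  have h : ∀ m : Fin D → ZMod N, ∏ i, mP Lc (zvec N p m i) = ∏ i, mP Lc (zrep N (p i) (m i)) := fun m => rfl
  simp_rw [h]
  rw [← Fintype.prod_sum (fun i (r : ZMod N) => mP Lc (zrep N (p i) r))]
  calc ∏ i, ∑ r : ZMod N, mP Lc (zrep N (p i) r) ≤ ∏ _i : Fin D, (1 + 4 * (Lc : ℝ)) :=
        Finset.prod_le_prod (fun _ _ => Finset.sum_nonneg fun _ _ => mP_nonneg _ _) fun i _ => sum_mP_zrep_le Lc (p i)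
    _ = (1 + 4 * (Lc : ℝ)) ^ D := by rw [Finset.prod_const, Finset.card_univ, Fintype.card_fin]

/-- [folklore] `0 ≤ Π_i mP Lc z_i`. -/
theorem prod_mP_nonneg (Lc : ℕ) (z : Fin D → ℤ) : 0 ≤ ∏ i, mP Lc (z i) := Finset.prod_nonneg fun _ _ => mP_nonneg _ _

/-- [folklore] `Π_i mP Lc z_i ≤ 1` fails in general, but the product with one factor ERASED is dominated after re-inserting any factor
`≤` the erased majorant: `(Π_{j ≠ i} mP_j)·x ≤ Π_j mP_j` for `x ≤ mP_i`. -/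
theorem prod_erase_mul_le {Lc : ℕ} (z : Fin D → ℤ) (i : Fin D) {x : ℝ} (hx : x ≤ mP Lc (z i)) :
    (∏ j ∈ Finset.univ.erase i, mP Lc (z j)) * x ≤ ∏ j, mP Lc (z j) := by
  rw [← Finset.prod_erase_mul Finset.univ (fun j => mP Lc (z j)) (Finset.mem_univ i)]
  exact mul_le_mul_of_nonneg_left hx (Finset.prod_nonneg fun _ _ => mP_nonneg _ _)

/-- [folklore] **DIRECTION-WISE DECAY OFF THE ZERO ALIAS**: for `z ≠ 0` and any coordinate `i`, `1/|p + 2πz|² ≤ mP Lc z_i/π²`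
(`|Q_i| ≥ π|z_i|` if `z_i ≠ 0`; `|Q|² ≥ π²` anyway — leaf P1-Y11s `pi_mul_abs_le` / `pi_sq_le_momSq_qv`; `Lc ≥ 1`). -/
theorem inv_momSq_qv_le {Lc : ℕ} (hLc : 1 ≤ Lc) {p : Fin D → ℝ} (hp : ∀ i, |p i| ≤ π) {z : Fin D → ℤ} (hz : z ≠ 0)
    (i : Fin D) : (momSq (qv p z))⁻¹ ≤ mP Lc (z i) / π ^ 2 := by
  have hπ := Real.pi_pos
  have hbig := pi_sq_le_momSq_qv hp hz
  have hm0 : 0 < momSq (qv p z) := lt_of_lt_of_le (by positivity) hbig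
  by_cases hzi : z i = 0
  · rw [hzi, mP_zero, one_div, inv_le_comm₀ hm0 (by positivity), inv_inv]
    exact hbig
  · have hfar : π * |(z i : ℝ)| ≤ |qv p z i| := pi_mul_abs_le (hp i) hzi
    have hzr : (0 : ℝ) < |(z i : ℝ)| := by
      have : (z i : ℝ) ≠ 0 := by exact_mod_cast hzi
      exact abs_pos.2 this
    have hQi : (π * |(z i : ℝ)|) ^ 2 ≤ momSq (qv p z) := by
      calc (π * |(z i : ℝ)|) ^ 2 ≤ qv p z i ^ 2 := by
            rw [← sq_abs (qv p z i)]; exact pow_le_pow_left₀ (by positivity) hfar 2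
        _ ≤ ∑ j, qv p z j ^ 2 := Finset.single_le_sum (f := fun j => qv p z j ^ 2) (fun j _ => sq_nonneg _) (Finset.mem_univ i)
    calc (momSq (qv p z))⁻¹ ≤ ((π * |(z i : ℝ)|) ^ 2)⁻¹ := inv_anti₀ (by positivity) hQi
      _ = ((z i : ℝ) ^ 2)⁻¹ / π ^ 2 := by rw [mul_pow, sq_abs, mul_inv, div_eq_mul_inv, mul_comm]
      _ ≤ mP Lc (z i) / π ^ 2 := div_le_div_of_nonneg_right (inv_sq_le_mP hLc hzi) (by positivity)

/-! ## §4 Complex product telescoping with majorants -/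

/-- [folklore] PRODUCT TELESCOPING WITH MAJORANTS (`ℂ`-valued twin of `ReadingWeightRatesSum.abs_prod_sub_prod_le_sum`): if `‖a_j‖ ≤ c_j`
and `‖b_j‖ ≤ c_j` on `s` then `‖Π_s a − Π_s b‖ ≤ Σ_{i∈s} ‖a_i − b_i‖·Π_{j ∈ s∖{i}} c_j`. -/
theorem norm_prod_sub_prod_le {ι : Type*} [DecidableEq ι] (s : Finset ι) (a b : ι → ℂ) (c : ι → ℝ)
    (ha : ∀ j ∈ s, ‖a j‖ ≤ c j) (hb : ∀ j ∈ s, ‖b j‖ ≤ c j) :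
    ‖∏ j ∈ s, a j - ∏ j ∈ s, b j‖ ≤ ∑ i ∈ s, ‖a i - b i‖ * ∏ j ∈ s.erase i, c j := by
  induction s using Finset.induction_on with
  | empty => simp
  | @insert k s hk ih =>
    have ha' : ∀ j ∈ s, ‖a j‖ ≤ c j := fun j hj => ha j (Finset.mem_insert_of_mem hj)
    have hb' : ∀ j ∈ s, ‖b j‖ ≤ c j := fun j hj => hb j (Finset.mem_insert_of_mem hj)
    have hA : ‖∏ j ∈ s, a j‖ ≤ ∏ j ∈ s, c j := by
      rw [norm_prod]
      exact Finset.prod_le_prod (fun _ _ => norm_nonneg _) ha'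
    have hbk : ‖b k‖ ≤ c k := hb k (Finset.mem_insert_self k s)
    rw [Finset.prod_insert hk, Finset.prod_insert hk, Finset.sum_insert hk, Finset.erase_insert hk]
    have hsum : ∑ i ∈ s, ‖a i - b i‖ * ∏ j ∈ (insert k s).erase i, c j
        = c k * ∑ i ∈ s, ‖a i - b i‖ * ∏ j ∈ s.erase i, c j := by
      rw [Finset.mul_sum]
      refine Finset.sum_congr rfl fun i hi => ?_
      have hki : k ≠ i := fun h => hk (h ▸ hi)
      rw [Finset.erase_insert_of_ne hki, Finset.prod_insert (fun h => hk (Finset.mem_of_mem_erase h))]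
      ring
    rw [hsum]
    calc ‖a k * ∏ j ∈ s, a j - b k * ∏ j ∈ s, b j‖
        ≤ ‖a k - b k‖ * ‖∏ j ∈ s, a j‖ + ‖b k‖ * ‖∏ j ∈ s, a j - ∏ j ∈ s, b j‖ := by
          have e : a k * ∏ j ∈ s, a j - b k * ∏ j ∈ s, b j
              = (a k - b k) * ∏ j ∈ s, a j + b k * (∏ j ∈ s, a j - ∏ j ∈ s, b j) := by ring
          rw [e]
          exact (norm_add_le _ _).trans (by rw [norm_mul, norm_mul])
      _ ≤ ‖a k - b k‖ * ∏ j ∈ s, c j + c k * ∑ i ∈ s, ‖a i - b i‖ * ∏ j ∈ s.erase i, c j :=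
          add_le_add (mul_le_mul_of_nonneg_left hA (norm_nonneg _))
            (mul_le_mul hbk (ih ha' hb') (norm_nonneg _) ((norm_nonneg _).trans hbk))

/-- [folklore] **THE `D`-FOLD PAIRED PRODUCT, BOUND**: at a label `Q = p + 2πz` of the level-`N` zone, `‖Π_i pairP N M Q_i‖ ≤ Π_i mP Lc z_i`. -/
theorem norm_prod_pairP_le {N M Lc : ℕ} (hN : 0 < N) (hM : 0 < M) (hLc : 0 < Lc) (hNM : (N : ℝ) = M * Lc) {p : Fin D → ℝ}
    (hp : ∀ i, |p i| ≤ π) {z : Fin D → ℤ} (hQ : ∀ i, |qv p z i| ≤ π * N) :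
    ‖∏ i, pairP N M (qv p z i)‖ ≤ ∏ i, mP Lc (z i) := by
  rw [norm_prod]
  exact Finset.prod_le_prod (fun _ _ => norm_nonneg _) fun i _ => norm_pairP_shift_le hN hM hLc hNM (hp i) (hQ i)

/-- [folklore] **THE `D`-FOLD PAIRED PRODUCT, TWO-LEVEL RATE (label-uniform form)**: at a label of the level-`N` zone,
`‖Π_i pairP N′ M′ Q_i − Π_i pairP N M Q_i‖ ≤ (π²/6)(Lc/N²)·Σ_i Π_{j≠i} mP Lc z_j`. -/
theorem norm_prod_pairP_sub_le {N M N' M' Lc : ℕ} (hN : 0 < N) (hM : 0 < M) (hN' : 0 < N') (hM' : 0 < M') (hLc : 0 < Lc)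
    (hNM : (N : ℝ) = M * Lc) (hN'M' : (N' : ℝ) = M' * Lc) (hNN' : N ≤ N') {p : Fin D → ℝ} (hp : ∀ i, |p i| ≤ π)
    {z : Fin D → ℤ} (hQ : ∀ i, |qv p z i| ≤ π * N) :
    ‖∏ i, pairP N' M' (qv p z i) - ∏ i, pairP N M (qv p z i)‖
      ≤ π ^ 2 / 6 * Lc / (N : ℝ) ^ 2 * ∑ i, ∏ j ∈ Finset.univ.erase i, mP Lc (z j) := by
  classical
  have hNN'r : (N : ℝ) ≤ N' := by exact_mod_cast hNN'
  have hQ' : ∀ i, |qv p z i| ≤ π * N' := fun i => (hQ i).trans (by nlinarith [Real.pi_pos])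
  have h := norm_prod_sub_prod_le Finset.univ (fun i => pairP N' M' (qv p z i)) (fun i => pairP N M (qv p z i))
    (fun i => mP Lc (z i)) (fun j _ => norm_pairP_shift_le hN' hM' hLc hN'M' (hp j) (hQ' j))
    (fun j _ => norm_pairP_shift_le hN hM hLc hNM (hp j) (hQ j))
  refine h.trans ?_
  rw [Finset.mul_sum]
  refine Finset.sum_le_sum fun i _ => ?_
  have hr := norm_pairP_sub_le_unif hN hM hN' hM' hLc hNM hN'M' hNN' (hQ i)
  exact mul_le_mul_of_nonneg_right hr (Finset.prod_nonneg fun _ _ => mP_nonneg _ _)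

end Summit.QuantumFields.BalabanUV.Beta.GAN24.SourceSideMajorant

end
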